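/-
Copyright (c) 2026. Released under Apache 2.0 license as described in the file LICENSE.
-/
import Summits.RiemannHypothesis.RiemannHypothesis.Theorems.LiDirichletKernelPositivity
import Summits.RiemannHypothesis.RiemannHypothesis.Theorems.LiDirichletKernelTableQ4
import Summits.RiemannHypothesis.RiemannHypothesis.Theorems.LiDirichletKernelTableQ8
import Summits.RiemannHypothesis.RiemannHypothesis.Theorems.LiDirichletKernelTableQ9a
import Summits.RiemannHypothesis.RiemannHypothesis.Theorems.LiDirichletKernelTableQ9b
import Summits.RiemannHypothesis.RiemannHypothesis.Theorems.LiDirichletKernelTableQ12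
import HarnessLib

/-!
# KERNEL LINEAGE K-χ — `Re λ_χ(n) > 0`, `n ≤ 48`, for EVERY primitive character of conductor `2 ≤ q ≤ 13`

RH-FREE DATA (a finite positivity range read off the kernel-certified Dirichlet Li table; no GRH-to-height input).
bears_on: LADDER-RH L-D (COLUMN 4 LI, Dirichlet rows; consumers `LiCriterionDirichlet.lean:95/194`).
WHAT THIS IS NOT: `Re λ_χ(n) > 0` for `n ≤ 48` is NOT Li's criterion for `L(s, χ)` (`∀ n`, GRH-EQUIVALENT,
`LiDirichlet.riemannHypothesis_iff_liCoeffCharRe_nonneg`); nothing here bears on the truth of RH or GRH.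

`LiDirichletKernelPositivity` removed the generator-value hypothesis of the table rows for PRIME `q ≤ 13`
(`liCoeffCharRe_pos_of_prime_le_13`, every `χ ≠ 1`).  This file does the same for the COMPOSITE conductors
`q ∈ {4, 8, 9, 12}` under the hypothesis the table rows carry anyway, `χ.IsPrimitive`, by classifying the characters of
`(ℤ/q)ˣ` through their values at the Conrey generators (`χ(g)^{ord g} = 1 ⇒ χ(g) = e(k/ord g)`,
`exists_rootOfUnity_of_pow_eq_one`) and discarding the imprimitive classes with an explicit factorisation through a
proper divisor `d ∣ q`: a character that is `1` on the kernel of `(ℤ/q)ˣ → (ℤ/d)ˣ` factors through `d`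
(`DirichletCharacter.factorsThrough_iff_ker_unitsMap`; here `factorsThrough_of_apply_eq_one`, a finite check over the
residues `m < q`), hence has conductor `≤ d < q` (`not_isPrimitive_of_factorsThrough`).  The kernels used:
`8 → 4`: `{1, 5}`; `9 → 3`: `{1, 4, 7}`; `12 → 4`: `{1, 5}`; `12 → 3`: `{1, 7}`; and for the moduli WITHOUT primitive
characters `2 → 1`, `6 → 3`, `10 → 5`: `{1}`.

Result `liCoeffCharRe_pos_of_isPrimitive_le_13`: for every `2 ≤ q ≤ 13`, every PRIMITIVE Dirichlet character `χ mod q`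
and every `1 ≤ n ≤ 48`, `0 < LiDirichlet.liCoeffCharRe χ n` — hypothesis-free over exactly the 37 primitive characters
of conductor `3 ≤ q ≤ 13` of the table of record (DATA.md §J/§U; `q = 2, 6, 10` carry none: `not_isPrimitive_q6/q10`,
and for `q = 2` the tree's `Literature.Barriers.Parity.MMSmoothing.not_isPrimitive_level_two`, re-derived inline).
Conductor form (any modulus, `χ ≠ 1`, `χ.conductor ≤ 13`): `liCoeffCharRe_primitiveCharacter_pos_of_conductor_le_13`
— the first 48 conditions `0 ≤ Re λ_{χ⋆}(n)` of `LiDirichlet.riemannHypothesis_iff_liCoeffCharRe_primitive_nonneg` hold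
unconditionally for every Dirichlet `L`-function of conductor `≤ 13` (`li_criterion_conditions_le_48_of_conductor_le_13`).
-/

set_option linter.dupNamespace false

namespace Summit.RiemannHypothesis.RiemannHypothesis.Theorems.LiDirichletKernel

open Literature.NumberTheory.LFunctions Literature.NumberTheory.LFunctions.LiDirichlet
open Summit.RiemannHypothesis.RiemannHypothesis.Theorems.LiTheory

/-! ## Factoring through a divisor from the values on a kernel -/

/-- A character `χ mod n` which is `1` at every unit residue `m < n` with `m ≡ 1 (mod d)` factors through `d ∣ n`
(`DirichletCharacter.factorsThrough_iff_ker_unitsMap` made finite). -/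
theorem factorsThrough_of_apply_eq_one {n d : ℕ} [NeZero n] (hd : d ∣ n) (χ : DirichletCharacter ℂ n)
    (h : ∀ m : ℕ, m < n → Nat.Coprime m n → ((m : ℕ) : ZMod d) = 1 → χ ((m : ℕ) : ZMod n) = 1) :
    χ.FactorsThrough d := by
  rw [DirichletCharacter.factorsThrough_iff_ker_unitsMap hd]
  intro x hx
  rw [MonoidHom.mem_ker] at hx ⊢
  have hu : (((x : ZMod n).val : ℕ) : ZMod n) = (x : ZMod n) := ZMod.natCast_zmod_val _
  have hcast : ((((x : ZMod n).val : ℕ)) : ZMod d) = 1 := by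
    have h1 : ((ZMod.unitsMap hd x : (ZMod d)ˣ) : ZMod d) = 1 := by rw [hx, Units.val_one]
    rwa [ZMod.unitsMap_val, ZMod.cast_eq_val] at h1
  have hval := h _ (ZMod.val_lt _) (ZMod.val_coe_unit_coprime x) hcast
  rw [hu] at hval
  exact Units.val_eq_one.1 (by rw [MulChar.coe_toUnitHom]; exact hval)

/-- A character factoring through a proper divisor is not primitive (its conductor is `≤ d < n`). -/
theorem not_isPrimitive_of_factorsThrough {n d : ℕ} [NeZero n] (χ : DirichletCharacter ℂ n)
    (h : χ.FactorsThrough d) (hdn : d < n) : ¬ χ.IsPrimitive := by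
  intro hp
  have hle : χ.conductor ≤ d := Nat.sInf_le ((DirichletCharacter.mem_conductorSet_iff χ).mpr h)
  rw [DirichletCharacter.isPrimitive_def] at hp
  omega

/-! ## Moduli without primitive characters (`q ≡ 2 mod 4`)

`q = 2` is the tree's `Literature.Barriers.Parity.MMSmoothing.not_isPrimitive_level_two` (re-derived inline in the final
theorem, not restated). -/

/-- No character `mod 6` is primitive (every one factors through `3`: the units `1, 5` reduce to `1, 2 mod 3`). -/
theorem not_isPrimitive_q6 (χ : DirichletCharacter ℂ 6) : ¬ χ.IsPrimitive :=
  not_isPrimitive_of_factorsThrough χ (d := 3)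
    (factorsThrough_of_apply_eq_one (by norm_num) χ fun m hm hcop hcast ↦ by
      interval_cases m
      all_goals first
        | exact absurd hcop (by decide)
        | exact absurd hcast (by decide)
        | (rw [Nat.cast_one, map_one])) (by norm_num)

/-- No character `mod 10` is primitive (every one factors through `5`: `(ℤ/10)ˣ → (ℤ/5)ˣ` is injective). -/
theorem not_isPrimitive_q10 (χ : DirichletCharacter ℂ 10) : ¬ χ.IsPrimitive :=
  not_isPrimitive_of_factorsThrough χ (d := 5)
    (factorsThrough_of_apply_eq_one (by norm_num) χ fun m hm hcop hcast ↦ by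
      interval_cases m
      all_goals first
        | exact absurd hcop (by decide)
        | exact absurd hcast (by decide)
        | (rw [Nat.cast_one, map_one])) (by norm_num)

/-! ## Composite conductors `4, 8, 9, 12` -/

/-- **`q = 4`**: for every primitive character `χ mod 4` (it is `4.3`, `χ(3) = −1`) and `1 ≤ n ≤ 48`, `Re λ_χ(n) > 0`
(kernel-certified rows; RH-FREE DATA). -/
theorem liCoeffCharRe_pos_q4 (χ : DirichletCharacter ℂ 4) (hprim : χ.IsPrimitive) {n : ℕ} (hn : 1 ≤ n)
    (hn' : n ≤ 48) : 0 < liCoeffCharRe χ n := by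
  have hpow : χ ((3 : ℕ) : ZMod 4) ^ 2 = 1 := by
    rw [← map_pow, show ((3 : ℕ) : ZMod 4) ^ 2 = 1 by decide, map_one]
  obtain ⟨k, hk, hval⟩ := exists_rootOfUnity_of_pow_eq_one (by norm_num) hpow
  interval_cases k
  · exact absurd (eq_one_of_apply_gen χ (g := 3) (by decide) (by decide) (by rw [hval]; exact rootOfUnity_zero 2))
      (ne_one_of_isPrimitive' hprim (by norm_num))
  · exact (liCoeffCharRe_row_q4_m3 χ hval hprim hn hn').2.2

/-- **`q = 8`**: for every primitive character `χ mod 8` (`8.5` or `8.3`, i.e. `χ(5) = −1`; `χ(5) = 1` factors through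
`4`) and `1 ≤ n ≤ 48`, `Re λ_χ(n) > 0` (kernel-certified rows; RH-FREE DATA). -/
theorem liCoeffCharRe_pos_q8 (χ : DirichletCharacter ℂ 8) (hprim : χ.IsPrimitive) {n : ℕ} (hn : 1 ≤ n)
    (hn' : n ≤ 48) : 0 < liCoeffCharRe χ n := by
  have hpow5 : χ ((5 : ℕ) : ZMod 8) ^ 2 = 1 := by
    rw [← map_pow, show ((5 : ℕ) : ZMod 8) ^ 2 = 1 by decide, map_one]
  have hpow7 : χ ((7 : ℕ) : ZMod 8) ^ 2 = 1 := by
    rw [← map_pow, show ((7 : ℕ) : ZMod 8) ^ 2 = 1 by decide, map_one]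
  obtain ⟨k, hk, h5⟩ := exists_rootOfUnity_of_pow_eq_one (by norm_num) hpow5
  obtain ⟨j, hj, h7⟩ := exists_rootOfUnity_of_pow_eq_one (by norm_num) hpow7
  interval_cases k
  · refine absurd hprim (not_isPrimitive_of_factorsThrough χ (d := 4) ?_ (by norm_num))
    refine factorsThrough_of_apply_eq_one (by norm_num) χ fun m hm hcop hcast ↦ ?_
    interval_cases m
    all_goals first
      | exact absurd hcop (by decide)
      | exact absurd hcast (by decide)
      | (rw [Nat.cast_one, map_one])
      | (rw [h5]; exact rootOfUnity_zero 2)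
  · interval_cases j
    · exact (liCoeffCharRe_row_q8_m5 χ h7 h5 hprim hn hn').2.2
    · exact (liCoeffCharRe_row_q8_m3 χ h7 h5 hprim hn hn').2.2

/-- **`q = 9`**: for every primitive character `χ mod 9` (`χ(2) = e(k/6)`, `k ∈ {1, 2, 4, 5}` = `9.2, 9.4, 9.7, 9.5`;
`k = 0` is principal and `k = 3` factors through `3`) and `1 ≤ n ≤ 48`, `Re λ_χ(n) > 0` (kernel-certified rows;
RH-FREE DATA). -/
theorem liCoeffCharRe_pos_q9 (χ : DirichletCharacter ℂ 9) (hprim : χ.IsPrimitive) {n : ℕ} (hn : 1 ≤ n)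
    (hn' : n ≤ 48) : 0 < liCoeffCharRe χ n := by
  have hpow : χ ((2 : ℕ) : ZMod 9) ^ 6 = 1 := by
    rw [← map_pow, show ((2 : ℕ) : ZMod 9) ^ 6 = 1 by decide, map_one]
  obtain ⟨k, hk, hval⟩ := exists_rootOfUnity_of_pow_eq_one (by norm_num) hpow
  interval_cases k
  · exact absurd (eq_one_of_apply_gen χ (g := 2) (by decide) (by decide) (by rw [hval]; exact rootOfUnity_zero 6))
      (ne_one_of_isPrimitive' hprim (by norm_num))
  · exact (liCoeffCharRe_row_q9_m2 χ hval hprim hn hn').2.2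
  · have h' : χ ((2 : ℕ) : ZMod 9) = rootOfUnity 3 1 := by
      rw [hval]; exact rootOfUnity_eq_of_mul (a := 2) (by norm_num) (by norm_num) (by norm_num) (by norm_num)
    exact (liCoeffCharRe_row_q9_m4 χ h' hprim hn hn').2.2
  · refine absurd hprim (not_isPrimitive_of_factorsThrough χ (d := 3) ?_ (by norm_num))
    refine factorsThrough_of_apply_eq_one (by norm_num) χ fun m hm hcop hcast ↦ ?_
    interval_cases m
    all_goals first
      | exact absurd hcop (by decide)
      | exact absurd hcast (by decide)
      | (rw [Nat.cast_one, map_one])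
      | (rw [char_apply_pow_eq χ (g := 2) (m := 4) (e := 2) (d := 6) (k := 3) (t := 0) (by norm_num) hval (by decide)
          (by decide)]; exact rootOfUnity_zero 6)
      | (rw [char_apply_pow_eq χ (g := 2) (m := 7) (e := 4) (d := 6) (k := 3) (t := 0) (by norm_num) hval (by decide)
          (by decide)]; exact rootOfUnity_zero 6)
  · have h' : χ ((2 : ℕ) : ZMod 9) = rootOfUnity 3 2 := by
      rw [hval]; exact rootOfUnity_eq_of_mul (a := 2) (by norm_num) (by norm_num) (by norm_num) (by norm_num)
    exact (liCoeffCharRe_row_q9_m7 χ h' hprim hn hn').2.2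
  · exact (liCoeffCharRe_row_q9_m5 χ hval hprim hn hn').2.2

/-- **`q = 12`**: for every primitive character `χ mod 12` (it is `12.11`, `χ(5) = χ(7) = −1`; `χ(5) = 1` factors
through `4`, `χ(7) = 1` through `3`) and `1 ≤ n ≤ 48`, `Re λ_χ(n) > 0` (kernel-certified rows; RH-FREE DATA). -/
theorem liCoeffCharRe_pos_q12 (χ : DirichletCharacter ℂ 12) (hprim : χ.IsPrimitive) {n : ℕ} (hn : 1 ≤ n)
    (hn' : n ≤ 48) : 0 < liCoeffCharRe χ n := by
  have hpow5 : χ ((5 : ℕ) : ZMod 12) ^ 2 = 1 := by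
    rw [← map_pow, show ((5 : ℕ) : ZMod 12) ^ 2 = 1 by decide, map_one]
  have hpow7 : χ ((7 : ℕ) : ZMod 12) ^ 2 = 1 := by
    rw [← map_pow, show ((7 : ℕ) : ZMod 12) ^ 2 = 1 by decide, map_one]
  obtain ⟨k, hk, h5⟩ := exists_rootOfUnity_of_pow_eq_one (by norm_num) hpow5
  obtain ⟨j, hj, h7⟩ := exists_rootOfUnity_of_pow_eq_one (by norm_num) hpow7
  interval_cases k
  · refine absurd hprim (not_isPrimitive_of_factorsThrough χ (d := 4) ?_ (by norm_num))
    refine factorsThrough_of_apply_eq_one (by norm_num) χ fun m hm hcop hcast ↦ ?_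
    interval_cases m
    all_goals first
      | exact absurd hcop (by decide)
      | exact absurd hcast (by decide)
      | (rw [Nat.cast_one, map_one])
      | (rw [h5]; exact rootOfUnity_zero 2)
  · interval_cases j
    · refine absurd hprim (not_isPrimitive_of_factorsThrough χ (d := 3) ?_ (by norm_num))
      refine factorsThrough_of_apply_eq_one (by norm_num) χ fun m hm hcop hcast ↦ ?_
      interval_cases m
      all_goals first
        | exact absurd hcop (by decide)
        | exact absurd hcast (by decide)
        | (rw [Nat.cast_one, map_one])
        | (rw [h7]; exact rootOfUnity_zero 2)
    · exact (liCoeffCharRe_row_q12_m11 χ h5 h7 hprim hn hn').2.2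

/-! ## All conductors `2 ≤ q ≤ 13` -/

/-- **POSITIVITY RANGE FOR EVERY PRIMITIVE CHARACTER OF CONDUCTOR `≤ 13`** (RH-FREE DATA; UNCONDITIONAL — no
GRH-to-height input; hypothesis-free over the 37 primitive characters of the kernel-certified table): for every
`2 ≤ q ≤ 13`, every primitive Dirichlet character `χ mod q` and every `1 ≤ n ≤ 48`,
`0 < Re λ_χ(n) = LiDirichlet.liCoeffCharRe χ n`.  (`q = 2, 6, 10` have no primitive character; prime `q` by
`liCoeffCharRe_pos_of_prime_le_13`.)  NOT Li's criterion (`∀ n`); nothing here bears on RH or GRH. -/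
theorem liCoeffCharRe_pos_of_isPrimitive_le_13 {q : ℕ} [NeZero q] (hq : 2 ≤ q) (hq' : q ≤ 13)
    (χ : DirichletCharacter ℂ q) (hprim : χ.IsPrimitive) {n : ℕ} (hn : 1 ≤ n) (hn' : n ≤ 48) :
    0 < liCoeffCharRe χ n := by
  obtain rfl | rfl | rfl | rfl | rfl | rfl | rfl | rfl | rfl | rfl | rfl | rfl :
      q = 2 ∨ q = 3 ∨ q = 4 ∨ q = 5 ∨ q = 6 ∨ q = 7 ∨ q = 8 ∨ q = 9 ∨ q = 10 ∨ q = 11 ∨ q = 12 ∨ q = 13 := by omega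
  · -- `q = 2`: no primitive character (the only unit is `1`; cf. `MMSmoothing.not_isPrimitive_level_two`)
    exact absurd hprim (not_isPrimitive_of_factorsThrough χ (d := 1)
      (factorsThrough_of_apply_eq_one (by norm_num) χ fun m hm hcop _ ↦ by
        interval_cases m
        · exact absurd hcop (by decide)
        · rw [Nat.cast_one, map_one]) (by norm_num))
  · exact liCoeffCharRe_pos_q3 χ (ne_one_of_isPrimitive' hprim (by norm_num)) hn hn'
  · exact liCoeffCharRe_pos_q4 χ hprim hn hn'
  · exact liCoeffCharRe_pos_q5 χ (ne_one_of_isPrimitive' hprim (by norm_num)) hn hn'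
  · exact absurd hprim (not_isPrimitive_q6 χ)
  · exact liCoeffCharRe_pos_q7 χ (ne_one_of_isPrimitive' hprim (by norm_num)) hn hn'
  · exact liCoeffCharRe_pos_q8 χ hprim hn hn'
  · exact liCoeffCharRe_pos_q9 χ hprim hn hn'
  · exact absurd hprim (not_isPrimitive_q10 χ)
  · exact liCoeffCharRe_pos_q11 χ (ne_one_of_isPrimitive' hprim (by norm_num)) hn hn'
  · exact liCoeffCharRe_pos_q12 χ hprim hn hn'
  · exact liCoeffCharRe_pos_q13 χ (ne_one_of_isPrimitive' hprim (by norm_num)) hn hn'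


/-! ## Any modulus: characters of conductor `≤ 13` (the `LiCriterionDirichlet` :305 form) -/

/-- **Conductor form** (RH-FREE DATA; UNCONDITIONAL): for a non-principal character `χ` of ANY modulus whose conductor
is `≤ 13` and every `1 ≤ n ≤ 48`, `0 < Re λ_{χ⋆}(n)`, `χ⋆ = χ.primitiveCharacter` the primitive character inducing `χ`
(the object of `LiDirichlet.riemannHypothesis_iff_liCoeffCharRe_primitive_nonneg`; `2 ≤ conductor` as `χ ≠ 1`).
NOT Li's criterion; nothing here bears on GRH. -/
theorem liCoeffCharRe_primitiveCharacter_pos_of_conductor_le_13 {q : ℕ} [NeZero q] (χ : DirichletCharacter ℂ q)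
    (hχ : χ ≠ 1) (hc : χ.conductor ≤ 13) {n : ℕ} (hn : 1 ≤ n) (hn' : n ≤ 48) :
    haveI : NeZero χ.conductor := ⟨χ.conductor_ne_zero⟩
    0 < liCoeffCharRe χ.primitiveCharacter n := by
  haveI : NeZero χ.conductor := ⟨χ.conductor_ne_zero⟩
  have h1 : χ.conductor ≠ 1 := fun h ↦ hχ (DirichletCharacter.eq_one_iff_conductor_eq_one.2 h)
  have h0 : χ.conductor ≠ 0 := χ.conductor_ne_zero
  exact liCoeffCharRe_pos_of_isPrimitive_le_13 (by omega) hc χ.primitiveCharacter χ.primitiveCharacter_isPrimitive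
    hn hn'

/-- **The first 48 inequalities of Li's GRH criterion hold for every Dirichlet `L`-function of conductor `≤ 13`**
(RH-FREE DATA; UNCONDITIONAL): for a non-principal `χ` of any modulus with `χ.conductor ≤ 13`, the condition
`0 ≤ Re λ_{χ⋆}(n)` on the right of `LiDirichlet.riemannHypothesis_iff_liCoeffCharRe_primitive_nonneg` holds (strictly)
for `1 ≤ n ≤ 48`.  WHAT THIS IS NOT: 48 of the infinitely many conditions of a GRH-EQUIVALENT criterion — not evidence
for, and nothing bearing on, GRH for `L(s, χ)`. -/
theorem li_criterion_conditions_le_48_of_conductor_le_13 {q : ℕ} [NeZero q] (χ : DirichletCharacter ℂ q)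
    (hχ : χ ≠ 1) (hc : χ.conductor ≤ 13) :
    haveI : NeZero χ.conductor := ⟨χ.conductor_ne_zero⟩
    ∀ n : ℕ, 1 ≤ n → n ≤ 48 → 0 ≤ liCoeffCharRe χ.primitiveCharacter n :=
  fun _ hn hn' ↦ (liCoeffCharRe_primitiveCharacter_pos_of_conductor_le_13 χ hχ hc hn hn').le


/-! ## Real (quadratic) primitive characters: Li's `λ_χ(n)` itself (the `LiCriterionDirichlet` :289 form) -/

open scoped ComplexOrder in
/-- **Quadratic characters**: for a REAL primitive character of conductor `2 ≤ q ≤ 13` (the nine quadratic characters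
`3.2, 4.3, 5.4, 7.6, 8.3, 8.5, 11.10, 12.11, 13.12`) and every `1 ≤ n ≤ 48`, Li's coefficient ITSELF (the symmetric
limit `liCoeffChar`, real by `liCoeffChar_of_real`) is a positive real: the first 48 conditions
`(0 : ℂ) ≤ λ_χ(n)` of `riemannHypothesis_iff_liCoeffChar_nonneg_of_real` hold unconditionally (strictly).  RH-FREE DATA;
NOT the criterion; nothing here bears on GRH. -/
theorem liCoeffChar_pos_of_real_le_13 {q : ℕ} [NeZero q] (hq : 2 ≤ q) (hq' : q ≤ 13) (χ : DirichletCharacter ℂ q)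
    (hprim : χ.IsPrimitive) (hreal : χ⁻¹ = χ) {n : ℕ} (hn : 1 ≤ n) (hn' : n ≤ 48) :
    liCoeffChar χ n = liCoeffCharRe χ n ∧ (0 : ℂ) < liCoeffChar χ n := by
  have h := liCoeffChar_of_real hprim (by omega) hreal n
  exact ⟨h, by rw [h]; exact Complex.zero_lt_real.2 (liCoeffCharRe_pos_of_isPrimitive_le_13 hq hq' χ hprim hn hn')⟩

end Summit.RiemannHypothesis.RiemannHypothesis.Theorems.LiDirichletKernel
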